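import Summits.QuantumAdvantage.AdviceFreeQNC0.TensorBlockFamily
import Summits.QuantumAdvantage.AdviceFreeQNC0.CrossTeamEmbedding
import HarnessLib

/-!
# Cell qa-qnc0 (tensor line of crux α; rungs R1U / S1'): LEMMA P (pullback is exact) and the
# FIBRE BOUND for the lift cost (planner qa-qnc0-p2 ROUND-5 §1, ask R5-b)

Statements VERBATIM from qn-p2 `line/Sketch5.lean` (`BMat`, `pullM`, `sliceM`, `minCost`,
`CostPullback`, `CostFibre`) and PROVED:

* `hw_eq_sum_sliceM` — the weight of a `2^L × 2^{L'+t}` matrix is the sum of the weights of its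
  `2^t` slices; `sliceM_pullM` — every slice of a pullback is the original matrix;
* `linCols_sliceM`, `rowsDeg_sliceM`, `linCols_pullM`, `rowsDeg_pullM` — slicing and pulling back
  preserve linear columns and degree-`d` rows; `minCost_le`, `exists_minCost_eq` (the minimum is
  attained: the zero matrix is admissible);
* **`costFibre : CostFibre`** (FIBRE BOUND): `Σ_r minCost d (sliceM r X) ≤ minCost d X`;
* **`costPullback : CostPullback`** (LEMMA P): `minCost d (pullM t X) = 2^t · minCost d X`.

WHAT THIS IS NOT: nothing on R1U / S1' themselves, `TRPlus`, `RingToElim` or the separation.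
-/

noncomputable section

namespace Summit.QuantumAdvantage.AdviceFreeQNC0

open Finset
open Literature.Computability.MetaComplexity Literature.Computability.MetaComplexity.Smolensky

/-! ### Vocabulary (verbatim from qn-p2 `line/Sketch5.lean`) -/

/-- Boolean `2^L × 2^{L'}` matrices. -/
abbrev BMat (L L' : ℕ) := (Fin L → Bool) → (Fin L' → Bool) → Bool

/-- pullback of a `2^L × 2^{L'}` matrix to `2^L × 2^{L'+t}` (constant along the last `t` coordinates). -/
def pullM {L L' : ℕ} (t : ℕ) (X : BMat L L') : BMat L (L' + t) :=
  fun u v => X u (fun i => v (Fin.castAdd t i))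

/-- the fibre (slice) of a `2^L × 2^{L'+t}` matrix over the last-`t`-coordinates value `r`. -/
def sliceM {L L' t : ℕ} (r : Fin t → Bool) (X : BMat L (L' + t)) : BMat L L' :=
  fun u v => X u (Fin.append v r)

/-- the minimal lift cost `min { hw (X ⊕ W) : W with linear columns and degree-d rows }`. -/
noncomputable def minCost {L L' : ℕ} (d : ℕ) (X : BMat L L') : ℕ :=
  sInf {c : ℕ | ∃ W : BMat L L', LinCols W ∧ RowsDeg d W ∧ hw (xorM X W) = c}

/-- **LEMMA P** (pullback is exact): `minCost d (pullM t X) = 2^t · minCost d X`. -/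
def CostPullback : Prop :=
  ∀ (L L' d t : ℕ) (X : BMat L L'), minCost d (pullM t X) = 2 ^ t * minCost d X

/-- **FIBRE BOUND**: the lift cost of `X` on `{0,1}^{L'+t}` is at least the sum over the `2^t` fibres
of the lift costs of the slices. -/
def CostFibre : Prop :=
  ∀ (L L' d t : ℕ) (X : BMat L (L' + t)),
    (∑ r : Fin t → Bool, minCost d (sliceM r X)) ≤ minCost d X

/-! ### Slices and pullbacks -/

variable {L L' t : ℕ}

/-- The weight of a matrix as a double sum of indicators. -/
theorem hw_eq_sum (M : BMat L L') :
    hw M = ∑ u : Fin L → Bool, ∑ v : Fin L' → Bool, (if M u v = true then (1 : ℕ) else 0) := by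
  unfold hw
  rw [Finset.card_filter, ← Finset.univ_product_univ, Finset.sum_product]

/-- **The weight is the sum of the weights of the slices.** -/
theorem hw_eq_sum_sliceM (M : BMat L (L' + t)) :
    hw M = ∑ r : Fin t → Bool, hw (sliceM r M) := by
  have hR : ∀ r : Fin t → Bool, hw (sliceM r M) =
      ∑ u : Fin L → Bool, ∑ v : Fin L' → Bool, (if M u (Fin.append v r) = true then (1 : ℕ) else 0) :=
    fun r => hw_eq_sum _
  simp_rw [hR]
  rw [hw_eq_sum]
  conv_rhs => rw [Finset.sum_comm]
  refine Finset.sum_congr rfl fun u _ => ?_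
  rw [← (Fin.appendEquiv L' t).sum_comp, Fintype.sum_prod_type, Finset.sum_comm]
  rfl

/-- Slices of a pullback are the original matrix. -/
theorem sliceM_pullM (r : Fin t → Bool) (X : BMat L L') : sliceM r (pullM t X) = X := by
  funext u v
  unfold sliceM pullM
  congr 1
  funext i
  exact Fin.append_left v r i

/-- Slicing commutes with `xorM`. -/
theorem sliceM_xorM (r : Fin t → Bool) (X W : BMat L (L' + t)) :
    sliceM r (xorM X W) = xorM (sliceM r X) (sliceM r W) := rfl

/-- Pulling back commutes with `xorM`. -/
theorem pullM_xorM (X W : BMat L L') : pullM t (xorM X W) = xorM (pullM t X) (pullM t W) := rfl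

/-- The weight of a pullback. -/
theorem hw_pullM (M : BMat L L') : hw (pullM t M) = 2 ^ t * hw M := by
  rw [hw_eq_sum_sliceM]
  simp_rw [sliceM_pullM]
  rw [Finset.sum_const, Finset.card_univ, Fintype.card_fun, Fintype.card_bool, Fintype.card_fin,
    smul_eq_mul]

/-- Slicing preserves linear columns. -/
theorem linCols_sliceM (r : Fin t → Bool) {W : BMat L (L' + t)} (hW : LinCols W) :
    LinCols (sliceM r W) :=
  ⟨fun v => hW.1 (Fin.append v r), fun v => hW.2 (Fin.append v r)⟩

/-- Slicing preserves degree-`d` rows. -/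
theorem rowsDeg_sliceM {d : ℕ} (r : Fin t → Bool) {W : BMat L (L' + t)} (hW : RowsDeg d W) :
    RowsDeg d (sliceM r W) :=
  fun u => hasDeg_append_left r (hW u)

/-- Pulling back preserves linear columns. -/
theorem linCols_pullM {W : BMat L L'} (hW : LinCols W) : LinCols (pullM t W) :=
  ⟨fun v => hW.1 (fun i => v (Fin.castAdd t i)), fun v => hW.2 (fun i => v (Fin.castAdd t i))⟩

/-- Pulling back preserves degree-`d` rows (composition with a coordinate projection). -/
theorem rowsDeg_pullM {d : ℕ} {W : BMat L L'} (hW : RowsDeg d W) : RowsDeg d (pullM t W) := by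
  intro u
  have h := hW u
  unfold HasDeg at h ⊢
  exact comp_mem_lowDeg_of_coord (fun v : Fin (L' + t) → Bool => fun i => v (Fin.castAdd t i))
    (fun i => TensorBlock.hasDeg_coord (Fin.castAdd t i)) h

/-! ### The minimum is attained; upper bounds -/

/-- The zero matrix is admissible. -/
theorem linCols_zero : LinCols (fun (_ : Fin L → Bool) (_ : Fin L' → Bool) => false) :=
  ⟨fun _ => hasDeg_false 1, fun _ => rfl⟩

/-- `minCost` is a lower bound for every admissible `W`. -/
theorem minCost_le {d : ℕ} (X : BMat L L') {W : BMat L L'} (hW : LinCols W) (hWd : RowsDeg d W) :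
    minCost d X ≤ hw (xorM X W) :=
  Nat.sInf_le ⟨W, hW, hWd, rfl⟩

/-- `minCost` is attained. -/
theorem exists_minCost_eq (d : ℕ) (X : BMat L L') :
    ∃ W : BMat L L', LinCols W ∧ RowsDeg d W ∧ hw (xorM X W) = minCost d X :=
  Nat.sInf_mem (⟨hw (xorM X fun _ _ => false), fun _ _ => false, linCols_zero,
    fun _ => hasDeg_false d, rfl⟩ :
    {c : ℕ | ∃ W : BMat L L', LinCols W ∧ RowsDeg d W ∧ hw (xorM X W) = c}.Nonempty)

/-! ### FIBRE BOUND and LEMMA P -/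

/-- **FIBRE BOUND `CostFibre`.** -/
theorem costFibre : CostFibre := by
  intro L L' d t X
  obtain ⟨W, hW, hWd, hc⟩ := exists_minCost_eq d X
  rw [← hc, hw_eq_sum_sliceM]
  refine Finset.sum_le_sum fun r _ => ?_
  rw [sliceM_xorM]
  exact minCost_le _ (linCols_sliceM r hW) (rowsDeg_sliceM r hWd)

/-- **LEMMA P `CostPullback`.** -/
theorem costPullback : CostPullback := by
  intro L L' d t X
  apply le_antisymm
  · -- pull back an optimal `W`
    obtain ⟨W, hW, hWd, hc⟩ := exists_minCost_eq d X
    calc minCost d (pullM t X) ≤ hw (xorM (pullM t X) (pullM t W)) :=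
          minCost_le _ (linCols_pullM hW) (rowsDeg_pullM hWd)
      _ = 2 ^ t * minCost d X := by rw [← pullM_xorM, hw_pullM, hc]
  · -- the fibre bound, all slices being `X`
    have h := costFibre L L' d t (pullM t X)
    simp_rw [sliceM_pullM] at h
    rwa [Finset.sum_const, Finset.card_univ, Fintype.card_fun, Fintype.card_bool, Fintype.card_fin,
      smul_eq_mul] at h

end Summit.QuantumAdvantage.AdviceFreeQNC0

end
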